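import Summits.QuantumFields.BalabanUV.Beta.GAN24.SoftColumnConsistency

/-!
# `BalabanUV.Beta.GAN24.HardColumnLetters` — binder row G-an2-4 ∕ (CONV-C), route R7: THE PHYSICAL HARD COLUMN `h = H_k e_q` (the field B12
# p. 265 puts in the exponent, `U_kU*_{k+1} = exp iηH_k(B′)`) AS A VERTEX BACKGROUND — ALL THREE LETTERS (size, Lipschitz, consistency at the
# block parent) ARE TREE THEOREMS, so the V3-type dressed chains of `DressedOrderZeroChainRate` with HARD columns in the vertex slots are
# UNCONDITIONAL (soft legs `M̃` and hard legs `M̂ = n^{−d∕2}H_k`), every `a > 0`, every `L ≥ 1`, every torus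

NOT IN PRINT; OUR PROOF ATTEMPT (prover part P3 of row G-an2-4, fibre∕strip («Woodbury») lineage, gen 27; CRUX TEAM (2), ruling «YM
REDIRECT TOWARDS THE SUMMIT», 2026-08-21).  HONEST DEPENDENCY (cell records, verbatim): «continuum YM on T⁴ ⇐ BetaPertH ∧ nine spine
estimates (0/9 proved); BetaPertH ⇐ (D1) ∧ (D4) ∧ CAP+tail; G-an2-4 gates asym, D1 and NE2/3/4.»  HONEST FRAMING (cell contract, verbatim):
«discharging `BetaPertH` makes Bałaban's UV stability UNCONDITIONAL — a real constructive-QFT result; it is NOT the continuum limit and NOT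
the Clay problem.»  ABSOLUTE RULE: nothing printed is a hypothesis; no `def … : Prop`, no sorry; [folklore] assembly over TREE objects BY NAME.

## Content

The companion `SoftColumnConsistency` (this gen) closed the three letters for the SOFT column `a·n^d·𝒢_aQ_kᴴe_q`.  Here the same for the HARD
column `hcolBG q k X := H_k(X, q)` (b05's typed `B5Hk163Torus.HkOp`, the hard minimiser applied to the unit delta at the coarse bond `q`):
 * §1 `hcolBG`; **`norm_hcolBG_le`** (`≤ KH d`, leaf-03's row sums `sum_norm_HkOp_le`); **`norm_hcolBG_sub_shiftBack_le`** (`≤ KHg d ∕ n_k`, gen 26's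
   gradient row sums `sum_norm_fdiff_HkOp_le`); **`norm_hcolBG_succ_sub_parT_le`** (`≤ KH1s d·(L⁻¹)^k`, THIS GEN's `sum_norm_HkOp_par_sub_le` — the
   `H_k` one-step law against King's parent), `exists_hcons_hard`.
 * §2 **`norm_softLegHardColumnChain_succ_sub_le`** ∕ **`norm_hardLegHardColumnChain_succ_sub_le`**: gen 26 (F) (`DressedOrderZeroChainRate`) with
   `W₁ = hcolBG q₁`, `W₂ = hcolBG q₂`, `α = KH d`, `β = KHg d`, `δ k = KH1s d·(L⁻¹)^k` — NO hypothesis.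

HONEST SCOPE.  [folklore] bookkeeping BY NAME; `U = 1`; MODEL chains (S1∕S7 are an2's∕p1's); NOT (CONV-C) as a whole, NEVER «G-an2-4 closed», NOT NE2,
NOT D1, NOT BetaPertH, NOT continuum, NOT Clay.  Locators (text only): [Balaban1984PropagatorsI] (1.63) p. 28; [Balaban1987RGI] p. 265 (the
field `exp iηH_k(B′)`).  Provenance: prover-b2b-balaban-gan24-p3-g27-0 (unit `b2b-balaban-gan24-p3`, gen 27), 2026-08-21.
-/

noncomputable section

open scoped BigOperators ComplexConjugate Matrix Matrix.Norms.L2Operator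
open Finset

namespace Summit.QuantumFields.BalabanUV.Beta.GAN24.HardColumnLetters

open Literature.MathematicalPhysics.QuantumFieldTheory.Balaban1983to89
open Literature.MathematicalPhysics.QuantumFieldTheory.Balaban1983to89.B5Prop11Plancherel (Tor fine fdiff unitVec Cst)
open Literature.MathematicalPhysics.QuantumFieldTheory.Balaban1983to89.B5G183RateUnitTower (lev lev_neZero)
open Literature.MathematicalPhysics.QuantumFieldTheory.Balaban1983to89.B5Hk163Torus (HkOp)
open Summit.QuantumFields.BalabanUV.T4Continuum
open Summit.QuantumFields.BalabanUV.T4Continuum.BalabanAveragedTowerUnit (idx lev_succ' one_le_lev' cast_lev')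
open Summit.QuantumFields.BalabanUV.T4Continuum.BalabanAveragedCoerciveTower (unitIdx)
open Summit.QuantumFields.BalabanUV.T4Continuum.BalabanAveragedCoercive (gammaB gammaB_pos)
open Summit.QuantumFields.BalabanUV.T4Continuum.BalabanMinimizerLaw
open Summit.QuantumFields.BalabanUV.T4Continuum.BlockPairingGeometry (parT)
open Summit.QuantumFields.BalabanUV.Beta.GAN24.SoftColumnSupLetter (KH KH_nonneg sum_norm_HkOp_le)
open Summit.QuantumFields.BalabanUV.Beta.GAN24.SoftColumnGradSupLetter (KHg KHg_nonneg sum_norm_fdiff_HkOp_le fdiff_mul_apply)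
open Summit.QuantumFields.BalabanUV.Beta.GAN24.DressedOrderZeroSlotLaw (shiftBack)
open Summit.QuantumFields.BalabanUV.Beta.GAN24.OrderZeroSlotLaw (CK)
open Summit.QuantumFields.BalabanUV.Beta.GAN24.DressedOrderZeroChain (DRop DRopsucc)
open Summit.QuantumFields.BalabanUV.Beta.GAN24.DressedOrderZeroChainRate (norm_softDressedChain_succ_sub_le_rate
  norm_hardDressedChain_succ_sub_le_rate)
open Summit.QuantumFields.BalabanUV.Beta.GAN24.HardColumnChains (Mhat CHH)
open Summit.QuantumFields.BalabanUV.Beta.GAN24.HkKingOneStepSup (KH1s KH1s_nonneg sum_norm_HkOp_par_sub_le)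

variable {d : ℕ} (L : ℕ) [NeZero L] (M : Fin (d + 1) → ℕ) [hM : ∀ μ, NeZero (M μ)] (a : ℝ) (ha : 0 < a)

/-! ## §1 The hard column and its three background letters -/

/-- **THE PHYSICAL HARD COLUMN AS A BACKGROUND FIELD**: `hcolBG q k X := H_k(X, q)` — the hard minimiser `H_k` of (1.63) applied to the unit delta
at the coarse bond `q`, read at the fine bond `X` of level `k`. [cite: Balaban1984PropagatorsI, (1.63) p.28] [folklore] -/
def hcolBG (q : idx L M 0) (k : ℕ) : idx L M k → ℂ :=
  fun X => HkOp (lev L k) M X (unitIdx L M q)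

omit [NeZero L] in
/-- a single entry is bounded by the row sum of norms. [folklore] -/
theorem norm_apply_le_sum {ι κ : Type*} [Fintype κ] (A : Matrix ι κ ℂ) (X : ι) (q : κ) :
    ‖A X q‖ ≤ ∑ q', ‖A X q'‖ :=
  Finset.single_le_sum (f := fun q' => ‖A X q'‖) (fun _ _ => norm_nonneg _) (Finset.mem_univ q)

/-- **the SIZE letter**: `‖hcolBG q k X‖ ≤ KH d` (leaf-03's `sum_norm_HkOp_le`). [folklore] -/
theorem norm_hcolBG_le (q : idx L M 0) (k : ℕ) (X : idx L M k) : ‖hcolBG L M q k X‖ ≤ KH d :=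
  (norm_apply_le_sum (HkOp (lev L k) M) X (unitIdx L M q)).trans (sum_norm_HkOp_le M (lev L k) X)

/-- **the LIPSCHITZ letter**: `‖hcolBG q k X − hcolBG q k (X − e_μ)‖ ≤ KHg d ∕ n_k` (gen 26's gradient row sums `sum_norm_fdiff_HkOp_le` at the
fine bond `X − e_μ`). [folklore] -/
theorem norm_hcolBG_sub_shiftBack_le (q : idx L M 0) (k : ℕ) (μ : Fin (d + 1)) (X : idx L M k) :
    ‖hcolBG L M q k X - shiftBack (lev L k) M μ (hcolBG L M q k) X‖ ≤ KHg d / (lev L k : ℕ) := by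
  have hn : (0 : ℝ) < (lev L k : ℕ) := by exact_mod_cast one_le_lev' L k
  have hnC : (((lev L k : ℕ)) : ℂ) ≠ 0 := by exact_mod_cast (Nat.pos_iff_ne_zero.mp (one_le_lev' L k))
  set Y : idx L M k := (X.1 - unitVec (fine (lev L k) M) μ, X.2) with hY
  have hXY : (Y.1 + unitVec (fine (lev L k) M) μ, Y.2) = X := by
    rw [hY]; simp only [sub_add_cancel, Prod.mk.eta]
  have hg := (norm_apply_le_sum (fdiff (fine (lev L k) M) ((lev L k : ℕ) : ℂ) μ * HkOp (lev L k) M) Y (unitIdx L M q)).trans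
    (sum_norm_fdiff_HkOp_le M (lev L k) μ Y)
  rw [fdiff_mul_apply, hXY] at hg
  have e : hcolBG L M q k X - shiftBack (lev L k) M μ (hcolBG L M q k) X
      = ((((lev L k : ℕ)) : ℂ))⁻¹
          * ((((lev L k : ℕ)) : ℂ) * (HkOp (lev L k) M X (unitIdx L M q) - HkOp (lev L k) M Y (unitIdx L M q))) := by
    simp only [hcolBG, shiftBack, hY]
    field_simp
  rw [e, norm_mul, norm_inv, Complex.norm_natCast, div_eq_inv_mul]
  exact mul_le_mul_of_nonneg_left hg (inv_nonneg.mpr hn.le)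

/-- **the CONSISTENCY letter at the block parent**: `‖hcolBG q (k+1) X′ − hcolBG q k (parT X′)‖ ≤ KH1s d·(L⁻¹)^k` — THIS GEN's `H_k` one-step law
against King's parent (`HkKingOneStepSup.sum_norm_HkOp_par_sub_le`). [cite: King1986, Prop. 3.8 (3.71) p.664 (scalar template)] [folklore] -/
theorem norm_hcolBG_succ_sub_parT_le (q : idx L M 0) (k : ℕ) (X' : idx L M (k + 1)) :
    ‖hcolBG L M q (k + 1) X' - hcolBG L M q k (parT (lev L k) L M X')‖ ≤ KH1s d * ((L : ℝ)⁻¹) ^ k := by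
  have h := sum_norm_HkOp_par_sub_le (N := lev L k) (R := L) M X'
  have h1 := (norm_apply_le_sum (fun (X : idx L M (k + 1)) (i : Tor M × Fin (d + 1)) =>
      HkOp (L * lev L k) M X i - HkOp (lev L k) M (BalabanAveragedTowerModes.par (lev L k) L M X.1, X.2) i) X' (unitIdx L M q)).trans h
  rw [cast_lev', div_eq_mul_inv, ← inv_pow] at h1
  exact h1

/-- the consistency letter in the `∃`-shape (nonnegative, geometric). [folklore] -/
theorem exists_hcons_hard :
    ∃ δ : ℕ → ℝ, (∀ k, 0 ≤ δ k) ∧ (∃ C : ℝ, 0 ≤ C ∧ ∀ k, δ k ≤ C * ((L : ℝ)⁻¹) ^ k) ∧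
      ∀ (q : idx L M 0) (k : ℕ) (X' : idx L M (k + 1)),
        ‖hcolBG L M q (k + 1) X' - hcolBG L M q k (parT (lev L k) L M X')‖ ≤ δ k :=
  ⟨fun k => KH1s d * ((L : ℝ)⁻¹) ^ k, fun k => by have := KH1s_nonneg d; positivity, ⟨KH1s d, KH1s_nonneg d, fun k => le_rfl⟩,
    norm_hcolBG_succ_sub_parT_le L M⟩

/-! ## §2 The V3-type dressed chains with HARD columns in both vertex slots: no letter left -/

/-- **SOFT LEGS, HARD COLUMNS IN THE VERTEX SLOTS — UNCONDITIONAL** (gen 26 (F) `norm_softDressedChain_succ_sub_le_rate` with the three letters of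
§1). [folklore] -/
theorem norm_softLegHardColumnChain_succ_sub_le (q₁ q₂ : idx L M 0) (k : ℕ) (μ μ' : Fin (d + 1)) (p r : idx L M 0) :
    ‖((atSucc' L M k (Mtil L M a ha (k + 1)))ᴴ * DRopsucc L M a ha (hcolBG L M q₁) (hcolBG L M q₂) k μ μ'
          * atSucc' L M k (Mtil L M a ha (k + 1))
        - (Mtil L M a ha k)ᴴ * DRop L M a ha (hcolBG L M q₁) (hcolBG L M q₂) k μ μ' * Mtil L M a ha k) p r‖
      ≤ 2 * ((a * Cst (d + 1) a) * ((KH d + KHg d) * ((KH d + KHg d) * Cst (d + 1) a)) * (a * CQH (d + 1) a * ((L : ℝ)⁻¹) ^ k))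
          + (a * Cst (d + 1) a) * (KH d * KH d * CK (d + 1) L a * ((L : ℝ)⁻¹) ^ k
              + 2 * KH d * ((L : ℝ) * L) * Cst (d + 1) a * (KH1s d * ((L : ℝ)⁻¹) ^ k)) * (a * Cst (d + 1) a) :=
  norm_softDressedChain_succ_sub_le_rate L M a ha (by omega) (hcolBG L M q₁) (hcolBG L M q₂) (KH_nonneg d) (KHg_nonneg d)
    (fun k => by have := KH1s_nonneg d; positivity) (fun k i => norm_hcolBG_le L M q₁ k i) (fun k i => norm_hcolBG_le L M q₂ k i)
    (fun k μ i => norm_hcolBG_sub_shiftBack_le L M q₁ k μ i) (fun k μ i => norm_hcolBG_sub_shiftBack_le L M q₂ k μ i)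
    (fun k i => norm_hcolBG_succ_sub_parT_le L M q₁ k i) (fun k i => norm_hcolBG_succ_sub_parT_le L M q₂ k i) k μ μ' p r

/-- **HARD LEGS `M̂ = n^{−d∕2}H_k`, HARD COLUMNS IN THE VERTEX SLOTS — UNCONDITIONAL** (gen 26 (F) `norm_hardDressedChain_succ_sub_le_rate` with the
three letters of §1). [folklore] -/
theorem norm_hardLegHardColumnChain_succ_sub_le (q₁ q₂ : idx L M 0) (k : ℕ) (μ μ' : Fin (d + 1)) (p r : idx L M 0) :
    ‖((atSucc' L M k (Mhat L M a ha (k + 1)))ᴴ * DRopsucc L M a ha (hcolBG L M q₁) (hcolBG L M q₂) k μ μ'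
          * atSucc' L M k (Mhat L M a ha (k + 1))
        - (Mhat L M a ha k)ᴴ * DRop L M a ha (hcolBG L M q₁) (hcolBG L M q₂) k μ μ' * Mhat L M a ha k) p r‖
      ≤ 2 * ((Cst (d + 1) a * (gammaB (d + 1) a)⁻¹) * ((KH d + KHg d) * ((KH d + KHg d) * Cst (d + 1) a))
            * (CHH (d + 1) a * ((L : ℝ)⁻¹) ^ k))
          + (Cst (d + 1) a * (gammaB (d + 1) a)⁻¹) * (KH d * KH d * CK (d + 1) L a * ((L : ℝ)⁻¹) ^ k
              + 2 * KH d * ((L : ℝ) * L) * Cst (d + 1) a * (KH1s d * ((L : ℝ)⁻¹) ^ k)) * (Cst (d + 1) a * (gammaB (d + 1) a)⁻¹) :=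
  norm_hardDressedChain_succ_sub_le_rate L M a ha (by omega) (hcolBG L M q₁) (hcolBG L M q₂) (KH_nonneg d) (KHg_nonneg d)
    (fun k => by have := KH1s_nonneg d; positivity) (fun k i => norm_hcolBG_le L M q₁ k i) (fun k i => norm_hcolBG_le L M q₂ k i)
    (fun k μ i => norm_hcolBG_sub_shiftBack_le L M q₁ k μ i) (fun k μ i => norm_hcolBG_sub_shiftBack_le L M q₂ k μ i)
    (fun k i => norm_hcolBG_succ_sub_parT_le L M q₁ k i) (fun k i => norm_hcolBG_succ_sub_parT_le L M q₂ k i) k μ μ' p r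

end Summit.QuantumFields.BalabanUV.Beta.GAN24.HardColumnLetters

end
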